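import Summits.AtomisticToContinuum.HydrodynamicLimit.Theorems.CollisionIsometryCLTAdaptedWeightCLTBHEntropyBudgetCellLaw

/-!
# Entropy budget (stub `stub_entropyBudget`, line `block-h-dissipation-closure`, crux `AdaptedWeightCLT`,
stmt-AtomisticToContinuum-14868; `--supports`) — helper 3: the cell entropy and the deterministic bound
`|S_N(w)| ≤ C(h,δ) + π (N+1)⁻¹ Σ_i |v_i|²` (mechanism (ii) of the stub)

For a nonnegative unit-mass continuous kernel `ψ_N`, `h > 0`, `0 < δ ≤ 1`:
* `f̂ log f̂` is integrable, and the regularised CELL ENTROPY `H(f̂_x) = ∫ f̂ log f̂` satisfies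
  `m (log δ − (3/2) log 2π(θ̄+h²)) − 3/2 ≤ H(f̂_x) ≤ |log (2πh²)^{-3/2}|` (`m = ∫ f̂ ∈ {δ, 1}`): from above
  `f̂ ≤ (2πh²)^{-3/2}`, from below `f̂ ≥ δ M_{θ̄+h²,ū}` and the second moment `∫ f̂ |v−ū|² ≤ 3(θ̄+h²)`;
* MASS-WEIGHTED: `|cW · H(f̂_x)| ≤ (|log (2πh²)^{-3/2}| + |log δ| + 3πh²) cW + π Σ_i cw_i |v_i|²`
  (`log y ≤ y − 1` and the variance bound `cW θ̄ ≤ Σ cw_i |v_i|²/3`);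
* integrating over the torus (`∫ₓ cw_i = ∫ ψ_N = 1`): the ENTROPY BOUND
  `|S_N(w)| ≤ |log (2πh²)^{-3/2}| + |log δ| + 3πh² + π (N+1)⁻¹ Σ_i |v_i|²` — linear in the kinetic energy
  per particle, which is conserved along good orbits and `O_P(1)` under H2.
-/

namespace Summit.AtomisticToContinuum.HydrodynamicLimit.Theorems.BlockHDissipation

open scoped BigOperators Topology Classical MeasureTheory ENNReal InnerProductSpace
open Filter Set MeasureTheory
open Literature.Analysis.FluidPDE
open Summit.AtomisticToContinuum.HydrodynamicLimit.Theorems.ContactSourceDuhamel (T3 V3 Cfg Vel Flow Flows)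
open Literature.MathematicalPhysics.KineticTheory (localMaxwellian_pos localMaxwellian_nonneg continuous_localMaxwellian)

noncomputable section

namespace EntropyBudget

variable {N : ℕ} {ψ : ℕ → T3 → ℝ} {h δ : ℝ} (w : Cfg N) (x : T3)

/-! ## The cell entropy `H(f̂_x) = ∫ f̂ log f̂` -/

/-- `f̂ log f̂` is integrable (`|log f̂| ≤ Λ + |v−ū|²/(2h²)` against the Gaussian-mixture `f̂`). -/
theorem integrable_cellLaw_mul_log (hψ : ∀ y, 0 ≤ ψ N y) (hh : 0 < h) (hδ : 0 < δ) (hδ1 : δ ≤ 1) :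
    Integrable fun v => cellLaw N ψ h δ w x v * Real.log (cellLaw N ψ h δ w x v) := by
  set Λ : ℝ := |Real.log ((2 * Real.pi * h ^ 2) ^ (-(3 : ℝ) / 2))| + |Real.log δ| +
    3 / 2 * |Real.log (2 * Real.pi * (cT N ψ w x + h ^ 2))| with hΛ
  have hdom := integrable_cellLaw_mul_poly (δ := δ) w x hψ hh Λ (1 / (2 * h ^ 2)) (cU N ψ w x) 2
  refine hdom.mono' ((continuous_cellLaw w x).aestronglyMeasurable.mul
    (Real.measurable_log.comp (continuous_cellLaw w x).measurable).aestronglyMeasurable)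
    (Eventually.of_forall fun v => ?_)
  have hf := (cellLaw_pos w x hψ hh hδ hδ1 v).le
  rw [norm_mul, Real.norm_eq_abs, Real.norm_eq_abs, abs_of_nonneg hf]
  refine mul_le_mul_of_nonneg_left ?_ hf
  have := abs_log_cellLaw_le (δ := δ) w x hψ hh hδ hδ1 v
  calc |Real.log (cellLaw N ψ h δ w x v)| ≤ _ := this
    _ = Λ + 1 / (2 * h ^ 2) * ‖v - cU N ψ w x‖ ^ 2 := by rw [hΛ]; ring

/-- UPPER BOUND: `H(f̂_x) ≤ |log (2πh²)^{-3/2}|`. -/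
theorem cellEnt_le (hψ : ∀ y, 0 ≤ ψ N y) (hh : 0 < h) (hδ : 0 < δ) (hδ1 : δ ≤ 1) :
    cellEnt N ψ h δ w x ≤ |Real.log ((2 * Real.pi * h ^ 2) ^ (-(3 : ℝ) / 2))| := by
  unfold cellEnt
  have hm := integral_cellLaw_mem (δ := δ) w x hψ hh hδ.le hδ1
  calc ∫ v, cellLaw N ψ h δ w x v * Real.log (cellLaw N ψ h δ w x v)
      ≤ ∫ v, cellLaw N ψ h δ w x v * |Real.log ((2 * Real.pi * h ^ 2) ^ (-(3 : ℝ) / 2))| := by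
        refine integral_mono (integrable_cellLaw_mul_log w x hψ hh hδ hδ1)
          ((integrable_cellLaw w x hψ hh).mul_const _) fun v => ?_
        exact mul_le_mul_of_nonneg_left ((log_cellLaw_le w x hψ hh hδ hδ1 v).trans (le_abs_self _))
          (cellLaw_pos w x hψ hh hδ hδ1 v).le
    _ = (∫ v, cellLaw N ψ h δ w x v) * |Real.log ((2 * Real.pi * h ^ 2) ^ (-(3 : ℝ) / 2))| :=
        integral_mul_const _ _
    _ ≤ 1 * |Real.log ((2 * Real.pi * h ^ 2) ^ (-(3 : ℝ) / 2))| :=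
        mul_le_mul_of_nonneg_right hm.2 (abs_nonneg _)
    _ = _ := one_mul _

/-- LOWER BOUND with the mass `m = ∫ f̂`: `m (log δ − (3/2) log 2π(θ̄+h²)) − 3/2 ≤ H(f̂_x)`. -/
theorem cellEnt_ge_mass (hψ : ∀ y, 0 ≤ ψ N y) (hh : 0 < h) (hδ : 0 < δ) (hδ1 : δ ≤ 1) :
    (∫ v, cellLaw N ψ h δ w x v) * (Real.log δ - 3 / 2 * Real.log (2 * Real.pi * (cT N ψ w x + h ^ 2))) - 3 / 2 ≤
      cellEnt N ψ h δ w x := by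
  have hθ := theta_pos w x hψ hh
  set L : ℝ := Real.log δ - 3 / 2 * Real.log (2 * Real.pi * (cT N ψ w x + h ^ 2)) with hL
  set θ : ℝ := cT N ψ w x + h ^ 2 with hθdef
  -- the comparison integrand `f̂ · (L − |v−ū|²/(2θ))`
  have hI1 : Integrable fun v => cellLaw N ψ h δ w x v * L := (integrable_cellLaw w x hψ hh).mul_const _
  have hI2 : Integrable fun v => cellLaw N ψ h δ w x v * ‖v - cU N ψ w x‖ ^ 2 := by
    have := integrable_cellLaw_mul_poly (δ := δ) w x hψ hh 0 1 (cU N ψ w x) 2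
    simpa using this
  have hle : ∫ v, (cellLaw N ψ h δ w x v * L - (2 * θ)⁻¹ * (cellLaw N ψ h δ w x v * ‖v - cU N ψ w x‖ ^ 2)) ≤
      cellEnt N ψ h δ w x := by
    unfold cellEnt
    refine integral_mono (hI1.sub (hI2.const_mul _)) (integrable_cellLaw_mul_log w x hψ hh hδ hδ1) fun v => ?_
    have hf := (cellLaw_pos w x hψ hh hδ hδ1 v).le
    have hlog := log_cellLaw_ge w x hψ hh hδ hδ1 v
    have e : cellLaw N ψ h δ w x v * L - (2 * θ)⁻¹ * (cellLaw N ψ h δ w x v * ‖v - cU N ψ w x‖ ^ 2) =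
        cellLaw N ψ h δ w x v * (Real.log δ + (-(3 / 2) * Real.log (2 * Real.pi * (cT N ψ w x + h ^ 2)) -
          ‖v - cU N ψ w x‖ ^ 2 / (2 * (cT N ψ w x + h ^ 2)))) := by
      rw [hL, hθdef]; ring
    rw [e]
    exact mul_le_mul_of_nonneg_left hlog hf
  rw [integral_sub hI1 (hI2.const_mul _), integral_mul_const, integral_const_mul] at hle
  have hmom := integral_cellLaw_mul_norm_sub_sq_le (δ := δ) w x hψ hh hδ1
  have h32 : (2 * θ)⁻¹ * ∫ v, cellLaw N ψ h δ w x v * ‖v - cU N ψ w x‖ ^ 2 ≤ 3 / 2 := by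
    rw [inv_mul_le_iff₀ (by positivity)]
    linarith
  linarith

/-- LOWER BOUND: `−(|log δ| + (3/2)|log 2π(θ̄+h²)| + 3/2) ≤ H(f̂_x)` (any cell, `∫ f̂ ≤ 1`). -/
theorem cellEnt_ge (hψ : ∀ y, 0 ≤ ψ N y) (hh : 0 < h) (hδ : 0 < δ) (hδ1 : δ ≤ 1) :
    -(|Real.log δ| + 3 / 2 * |Real.log (2 * Real.pi * (cT N ψ w x + h ^ 2))| + 3 / 2) ≤ cellEnt N ψ h δ w x := by
  have h1 := cellEnt_ge_mass (δ := δ) w x hψ hh hδ hδ1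
  have hm := integral_cellLaw_mem (δ := δ) w x hψ hh hδ.le hδ1
  set m := ∫ v, cellLaw N ψ h δ w x v
  set L : ℝ := Real.log δ - 3 / 2 * Real.log (2 * Real.pi * (cT N ψ w x + h ^ 2))
  have hL : |L| ≤ |Real.log δ| + 3 / 2 * |Real.log (2 * Real.pi * (cT N ψ w x + h ^ 2))| := by
    calc |L| ≤ |Real.log δ| + |3 / 2 * Real.log (2 * Real.pi * (cT N ψ w x + h ^ 2))| := abs_sub _ _
      _ = _ := by rw [abs_mul, abs_of_pos (by norm_num : (0 : ℝ) < 3 / 2)]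
  have h2 : -|L| ≤ m * L := by
    have : |m * L| ≤ |L| := by
      rw [abs_mul, abs_of_nonneg hm.1]
      exact mul_le_of_le_one_left (abs_nonneg _) hm.2
    linarith [neg_abs_le (m * L)]
  linarith

/-- TWO-SIDED: `|H(f̂_x)| ≤ |log (2πh²)^{-3/2}| + |log δ| + (3/2)|log 2π(θ̄+h²)| + 3/2`. -/
theorem abs_cellEnt_le (hψ : ∀ y, 0 ≤ ψ N y) (hh : 0 < h) (hδ : 0 < δ) (hδ1 : δ ≤ 1) :
    |cellEnt N ψ h δ w x| ≤ |Real.log ((2 * Real.pi * h ^ 2) ^ (-(3 : ℝ) / 2))| + |Real.log δ| +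
      3 / 2 * |Real.log (2 * Real.pi * (cT N ψ w x + h ^ 2))| + 3 / 2 := by
  rw [abs_le]
  constructor
  · linarith [cellEnt_ge (δ := δ) w x hψ hh hδ hδ1, abs_nonneg (Real.log ((2 * Real.pi * h ^ 2) ^ (-(3 : ℝ) / 2)))]
  · linarith [cellEnt_le (δ := δ) w x hψ hh hδ hδ1, abs_nonneg (Real.log δ),
      abs_nonneg (Real.log (2 * Real.pi * (cT N ψ w x + h ^ 2)))]

/-! ## Mass-weighted bounds -/

/-- `cW · H(f̂_x) ≤ |log (2πh²)^{-3/2}| cW`. -/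
theorem cW_mul_cellEnt_le (hψ : ∀ y, 0 ≤ ψ N y) (hh : 0 < h) (hδ : 0 < δ) (hδ1 : δ ≤ 1) :
    cW N ψ w x * cellEnt N ψ h δ w x ≤ |Real.log ((2 * Real.pi * h ^ 2) ^ (-(3 : ℝ) / 2))| * cW N ψ w x := by
  rw [mul_comm]
  exact mul_le_mul_of_nonneg_right (cellEnt_le w x hψ hh hδ hδ1) (cW_nonneg w x hψ)

/-- `−(|log δ| + 3πh²) cW − π Σ_i cw_i |v_i|² ≤ cW · H(f̂_x)` (from the exact-temperature lower bound,
`log y ≤ y − 1`, and the variance bound). -/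
theorem cW_mul_cellEnt_ge (hψ : ∀ y, 0 ≤ ψ N y) (hh : 0 < h) (hδ : 0 < δ) (hδ1 : δ ≤ 1) :
    -(|Real.log δ| + 3 * Real.pi * h ^ 2) * cW N ψ w x - Real.pi * ∑ i, cw N ψ w x i * ‖(w i).2‖ ^ 2 ≤
      cW N ψ w x * cellEnt N ψ h δ w x := by
  have hsum : 0 ≤ ∑ i, cw N ψ w x i * ‖(w i).2‖ ^ 2 :=
    Finset.sum_nonneg fun i _ => mul_nonneg (cw_nonneg w x hψ i) (sq_nonneg _)
  by_cases hS : cW N ψ w x = 0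
  · rw [hS]; nlinarith [Real.pi_pos]
  have hSpos : 0 < cW N ψ w x := lt_of_le_of_ne (cW_nonneg w x hψ) (Ne.symm hS)
  have hθ := theta_pos (h := h) w x hψ hh
  have h1 := cellEnt_ge_mass (δ := δ) w x hψ hh hδ hδ1
  rw [integral_cellLaw w x hψ hh hS, one_mul] at h1
  -- `log(2πθ) ≤ 2πθ − 1`
  have hlog : Real.log (2 * Real.pi * (cT N ψ w x + h ^ 2)) ≤ 2 * Real.pi * (cT N ψ w x + h ^ 2) - 1 :=
    Real.log_le_sub_one_of_pos (by positivity)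
  have hvar := cW_mul_cT_le w x hψ
  have h2 : cW N ψ w x * (Real.log δ - 3 * Real.pi * (cT N ψ w x + h ^ 2)) ≤ cW N ψ w x * cellEnt N ψ h δ w x :=
    mul_le_mul_of_nonneg_left (by linarith) hSpos.le
  have h3 : -|Real.log δ| ≤ Real.log δ := neg_abs_le _
  nlinarith [Real.pi_pos]

/-- MASS-WEIGHTED CELL ENTROPY BOUND:
`|cW · H(f̂_x)| ≤ (|log (2πh²)^{-3/2}| + |log δ| + 3πh²) cW + π Σ_i cw_i |v_i|²`. -/
theorem abs_cW_mul_cellEnt_le (hψ : ∀ y, 0 ≤ ψ N y) (hh : 0 < h) (hδ : 0 < δ) (hδ1 : δ ≤ 1) :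
    |cW N ψ w x * cellEnt N ψ h δ w x| ≤
      (|Real.log ((2 * Real.pi * h ^ 2) ^ (-(3 : ℝ) / 2))| + |Real.log δ| + 3 * Real.pi * h ^ 2) * cW N ψ w x +
        Real.pi * ∑ i, cw N ψ w x i * ‖(w i).2‖ ^ 2 := by
  have hup := cW_mul_cellEnt_le (δ := δ) w x hψ hh hδ hδ1
  have hlo := cW_mul_cellEnt_ge (δ := δ) w x hψ hh hδ hδ1
  have hW := cW_nonneg (ψ := ψ) w x hψ
  have hsum : 0 ≤ ∑ i, cw N ψ w x i * ‖(w i).2‖ ^ 2 :=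
    Finset.sum_nonneg fun i _ => mul_nonneg (cw_nonneg w x hψ i) (sq_nonneg _)
  have h1 : 0 ≤ |Real.log ((2 * Real.pi * h ^ 2) ^ (-(3 : ℝ) / 2))| * cW N ψ w x :=
    mul_nonneg (abs_nonneg _) hW
  have h2 : 0 ≤ |Real.log δ| * cW N ψ w x := mul_nonneg (abs_nonneg _) hW
  have h3 : 0 ≤ 3 * Real.pi * h ^ 2 * cW N ψ w x := mul_nonneg (by positivity) hW
  have h4 : 0 ≤ Real.pi * ∑ i, cw N ψ w x i * ‖(w i).2‖ ^ 2 := mul_nonneg Real.pi_pos.le hsum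
  rw [abs_le]
  constructor
  · nlinarith
  · nlinarith

/-! ## Integration over the torus: the entropy bound -/

/-- The weights are continuous in the location. -/
theorem continuous_cw (hψc : Continuous (ψ N)) (i : Fin (N + 1)) : Continuous fun x => cw N ψ w x i :=
  hψc.comp (continuous_const.sub continuous_id)

/-- UNIT MASS OF THE WEIGHTS: `∫ₓ cw_i(x) dx = ∫ ψ_N = 1` (the Haar measure of `𝕋³` is invariant under
`x ↦ p − x`). -/
theorem integral_cw (hψ1 : ∫ y, ψ N y = 1) (i : Fin (N + 1)) : ∫ x, cw N ψ w x i = 1 := by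
  haveI : (volume : Measure T3).IsNegInvariant := Measure.IsAddHaarMeasure.isNegInvariant_of_regular volume
  unfold cw
  rw [integral_sub_left_eq_self (ψ N) volume (w i).1]
  exact hψ1

/-- **THE ENTROPY BOUND (mechanism (ii) of `stub_entropyBudget`).** For a nonnegative, unit-mass,
continuous kernel, `h > 0` and `0 < δ ≤ 1`:
`|S_N(w)| ≤ |log (2πh²)^{-3/2}| + |log δ| + 3πh² + π (N+1)⁻¹ Σ_i |v_i|²`. -/
theorem abs_entS_le (hψ : ∀ y, 0 ≤ ψ N y) (hψ1 : ∫ y, ψ N y = 1) (hψc : Continuous (ψ N)) (hh : 0 < h)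
    (hδ : 0 < δ) (hδ1 : δ ≤ 1) :
    |entS N ψ h δ w| ≤ (|Real.log ((2 * Real.pi * h ^ 2) ^ (-(3 : ℝ) / 2))| + |Real.log δ| + 3 * Real.pi * h ^ 2) +
      Real.pi * (((N + 1 : ℕ) : ℝ)⁻¹ * ∑ i, ‖(w i).2‖ ^ 2) := by
  set C : ℝ := |Real.log ((2 * Real.pi * h ^ 2) ^ (-(3 : ℝ) / 2))| + |Real.log δ| + 3 * Real.pi * h ^ 2 with hC
  have hN : (0 : ℝ) < ((N + 1 : ℕ) : ℝ) := by positivity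
  -- the integrable majorant `(N+1)⁻¹ (C cW + π Σ cw_i |v_i|²)`
  set g : T3 → ℝ := fun x => ((N + 1 : ℕ) : ℝ)⁻¹ * (C * cW N ψ w x + Real.pi * ∑ i, cw N ψ w x i * ‖(w i).2‖ ^ 2)
    with hg
  have hcwI : ∀ i, Integrable fun x => cw N ψ w x i := fun i => (continuous_cw w hψc i).integrable_unitAddTorus
  have hWI : Integrable fun x => cW N ψ w x := by
    unfold cW; exact integrable_finsetSum _ fun i _ => hcwI i
  have hsumI : Integrable fun x => ∑ i, cw N ψ w x i * ‖(w i).2‖ ^ 2 :=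
    integrable_finsetSum _ fun i _ => (hcwI i).mul_const _
  have hgI : Integrable g := ((hWI.const_mul C).add (hsumI.const_mul _)).const_mul _
  have hbound : ∀ x, ‖((N + 1 : ℕ) : ℝ)⁻¹ * cW N ψ w x * cellEnt N ψ h δ w x‖ ≤ g x := by
    intro x
    rw [Real.norm_eq_abs, mul_assoc, abs_mul, abs_of_pos (inv_pos.2 hN), hg]
    exact mul_le_mul_of_nonneg_left (abs_cW_mul_cellEnt_le w x hψ hh hδ hδ1) (inv_pos.2 hN).le
  have h1 : |entS N ψ h δ w| ≤ ∫ x, g x := by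
    unfold entS
    have := norm_integral_le_of_norm_le hgI (Eventually.of_forall hbound)
    rwa [Real.norm_eq_abs] at this
  -- evaluate the majorant
  have hgint : ∫ x, g x = ((N + 1 : ℕ) : ℝ)⁻¹ * (C * ((N + 1 : ℕ) : ℝ) + Real.pi * ∑ i, ‖(w i).2‖ ^ 2) := by
    rw [hg, integral_const_mul, integral_add (hWI.const_mul C) (hsumI.const_mul _), integral_const_mul,
      integral_const_mul]
    congr 2
    · unfold cW
      rw [integral_finsetSum _ fun i _ => hcwI i]
      simp_rw [integral_cw w hψ1]
      simp
    · rw [integral_finsetSum _ fun i _ => (hcwI i).mul_const _]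
      congr 1
      refine Finset.sum_congr rfl fun i _ => ?_
      rw [integral_mul_const, integral_cw w hψ1, one_mul]
  rw [hgint] at h1
  calc |entS N ψ h δ w| ≤ ((N + 1 : ℕ) : ℝ)⁻¹ * (C * ((N + 1 : ℕ) : ℝ) + Real.pi * ∑ i, ‖(w i).2‖ ^ 2) := h1
    _ = C + Real.pi * (((N + 1 : ℕ) : ℝ)⁻¹ * ∑ i, ‖(w i).2‖ ^ 2) := by field_simp

end EntropyBudget

/-- Registered anchor of this helper file (`--supports stmt-AtomisticToContinuum-14868`, helper of
`stub_entropyBudget`): the deterministic entropy bound `|S_N(w)| ≤ C(h,δ) + π (N+1)⁻¹ Σ_i |v_i|²`. -/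
theorem bhEntropyBudget_entropy_anchor : ∀ (N : ℕ) (ψ : ℕ → T3 → ℝ) (h δ : ℝ) (w : Cfg N), (∀ y, 0 ≤ ψ N y) → ∫ y, ψ N y = 1 → Continuous (ψ N) → 0 < h → 0 < δ → δ ≤ 1 → |entS N ψ h δ w| ≤ (|Real.log ((2 * Real.pi * h ^ 2) ^ (-(3 : ℝ) / 2))| + |Real.log δ| + 3 * Real.pi * h ^ 2) + Real.pi * (((N + 1 : ℕ) : ℝ)⁻¹ * ∑ i, ‖(w i).2‖ ^ 2) :=
  fun _ _ _ _ w hψ hψ1 hψc hh hδ hδ1 => EntropyBudget.abs_entS_le w hψ hψ1 hψc hh hδ hδ1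

end

end Summit.AtomisticToContinuum.HydrodynamicLimit.Theorems.BlockHDissipation
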